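import Summits.CriticalPhenomena.PercolationContinuityZ3.Theorems.PercNearOneGluingNoHeavyQuantFarBlockIntrinsicSharpCore
import Summits.CriticalPhenomena.PercolationContinuityZ3.Theorems.PercNearOneGluingNoHeavyQuantFarBlockIntrinsic
import HarnessLib

/-!
# QUANT lane R8, front "FAR beyond trees", layer one — the SHARP intrinsic criterion for a pendant block, II: graph level
# (FAR(1) in EVERY environment from the block's own numbers; necessary and sufficient for blocks of inside mean `≤ 2`)

builds on p205010 (kernel theorem, internal audit signed; external expert review pending)

Support file (`--supports stmt-CriticalPhenomena-4575`), seat `prim-quant-p1` (gen 24); memo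
`run/shared/lean/prim/quant/prim-quant-p1-g24/FOR-LEAD-INTRINSIC.md` §2.  Standard axioms; no sorries; no definitions.

SETTING as in `…QuantFarBlockLaw` / `…QuantFarBlockIntrinsic`: a block `Z` hangs at the cut vertex `c` (`o, c ∉ Z`, `w` vanishes between `Z` and
`(Z ∪ {c})ᶜ`); relays `A` with `P(o ↮ a) ≤ t` on `A` and `2 < Σ_{a∈A} P(o ↔ a)`; block numbers `h_S = P(X ≥ 1)`, `t_S = P(X ≥ 2)`
(`X = #{a ∈ A ∩ Z : c ↔ a on Z}`), a block relay `a₀` with internal marginal `τ₀ = P(c ↔ a₀ on Z)`, inside mean `M_in = Σ_{a∈A∩Z} P(c ↔ a on Z)`.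

* `Block.real_intrinsic_env_sharp` — environment lemma: for all reals `0 ≤ d ≤ h ≤ 1` with (B1♯) `τ₀(τ₀ − d) ≤ 2d(1−τ₀)`,
  (B2♯-light) `M_in + τ₀ ≤ 2 → τ₀ − d ≤ (h − d)(2 − M_in)`, (B2♯-medium) `2 < M_in + τ₀ → (τ₀ − d)(M_in + τ₀) ≤ 2(h − d)τ₀`, and `M_in ≤ 2`:
  `1 − t ≤ A₀ + B h + C d` (environment coefficients of `w`).
* **`Block.real_card_le_one_le_sharp`** — with `(h, d) = (h_S, t_S)`: `P_w(#{a ∈ A : o ↔ a} ≤ 1) ≤ t`, NO hypothesis on the graph outside `Z`.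
* **`Block.real_card_le_one_le_sharp₂`** — (B1♯) discharged by a second block relay of internal marginal `≥ τ₀` (Harris, `t_S ≥ τ₀²`).
WHAT THIS MEANS (memo §2).  For a pendant block with `M_in ≤ 2` and at least two relays, FAR at layer one holds in every environment iff it holds
in the two-parameter family of TREE environments "stem of weight `g` from the observer to `c` + one independent hair at the observer" iff (B2♯)
(necessity: take `g = min(1, 2/(M_in + τ₀))` and hair weight `↓ max(2 − M_in, gτ₀)`); for `M_in > 2` the stem alone shows `t_S ≥ τ₀` is necessary,
and it is sufficient (`Block.real_card_le_one_le_of_exit`).  Together with p1 g23's refutation of the environment-AGNOSTIC criterion this settles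
what block-locality means at layer one.  Numerically (memo §3) every pendant block examined (12 000 random cores × hub types, 21 junction families,
adversarial per-edge climbs) is `t_S ≥ τ₀` or satisfies (B2♯) with `M_in ≤ 2`.
[cite: Grimmett1999, §1.3 p. 10; Thm. (2.4) p. 34] (product measure, Harris); [cite: KozmaNitzan2024, Conjecture 3 (p. 15)] (context); [this work].
-/

noncomputable section

namespace Summit.CriticalPhenomena.PercolationContinuityZ3.Theorems

namespace Quant

namespace Block

open Finset MeasureTheory Set
open Literature.Probability.LatticeModels
open Literature.Probability.Percolation
open Bundle (offZ avoid offZ_subset real_offZ_event_eq_of_agree)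
open scoped Classical

variable {n : ℕ} {o c : Fin n} {Z : Finset (Fin n)}

/-- **Environment lemma, sharp form.**  Block `Z` at `c`, relays `A` with cuts `≤ t` and `EN > 2`, a block relay `a₀` (internal marginal `τ₀`),
inside mean `M_in ≤ 2`.  For all reals `0 ≤ d ≤ h ≤ 1` with (B1♯), (B2♯-light), (B2♯-medium): `1 − t ≤ A₀ + B·h + C·d`. [this work] -/
theorem real_intrinsic_env_sharp (w : Sym2 (Fin n) → unitInterval) (ho : o ∉ Z) (hc : c ∉ Z)
    (hw : ∀ x y : Fin n, x ≠ y → x ∈ Z → y ∉ Z → y ≠ c → (w s(x, y) : ℝ) = 0)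
    (A : Finset (Fin n)) (t : ℝ) {a₀ : Fin n} (ha₀ : a₀ ∈ A ∩ Z)
    (hcut : ∀ a ∈ A, (prodBernoulli w).real (openConn o a)ᶜ ≤ t)
    (hEN : (2 : ℝ) < ∑ a ∈ A, (prodBernoulli w).real (openConn o a))
    (hM : ∑ a ∈ A ∩ Z, (prodBernoulli w).real {ω | onZ Z ω ∈ openConn c a} ≤ 2)
    {h d : ℝ} (hd0 : 0 ≤ d) (hdh : d ≤ h) (hh1 : h ≤ 1)
    (hB1 : (prodBernoulli w).real {ω | onZ Z ω ∈ openConn c a₀} * ((prodBernoulli w).real {ω | onZ Z ω ∈ openConn c a₀} - d) ≤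
      2 * d * (1 - (prodBernoulli w).real {ω | onZ Z ω ∈ openConn c a₀}))
    (hB2l : ∑ a ∈ A ∩ Z, (prodBernoulli w).real {ω | onZ Z ω ∈ openConn c a} + (prodBernoulli w).real {ω | onZ Z ω ∈ openConn c a₀} ≤ 2 →
      (prodBernoulli w).real {ω | onZ Z ω ∈ openConn c a₀} - d ≤
        (h - d) * (2 - ∑ a ∈ A ∩ Z, (prodBernoulli w).real {ω | onZ Z ω ∈ openConn c a}))
    (hB2m : 2 < ∑ a ∈ A ∩ Z, (prodBernoulli w).real {ω | onZ Z ω ∈ openConn c a} + (prodBernoulli w).real {ω | onZ Z ω ∈ openConn c a₀} →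
      ((prodBernoulli w).real {ω | onZ Z ω ∈ openConn c a₀} - d) *
          (∑ a ∈ A ∩ Z, (prodBernoulli w).real {ω | onZ Z ω ∈ openConn c a} + (prodBernoulli w).real {ω | onZ Z ω ∈ openConn c a₀}) ≤
        2 * (h - d) * (prodBernoulli w).real {ω | onZ Z ω ∈ openConn c a₀}) :
    1 - t ≤ (prodBernoulli w).real {ω | 2 ≤ ((A \ Z).filter fun a => offZ Z ω ∈ openConn o a).card} +
      (prodBernoulli w).real {ω | ((A \ Z).filter fun a => offZ Z ω ∈ openConn o a).card = 1 ∧ offZ Z ω ∈ openConn o c} * h +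
      (prodBernoulli w).real {ω | ((A \ Z).filter fun a => offZ Z ω ∈ openConn o a).card = 0 ∧ offZ Z ω ∈ openConn o c} * d := by
  set μ := prodBernoulli w with hμ
  have hmeas : ∀ U : Set (BondConfig (Fin n)), MeasurableSet U := fun U => (Set.toFinite U).measurableSet
  set A0 := μ.real {ω | 2 ≤ ((A \ Z).filter fun a => offZ Z ω ∈ openConn o a).card} with hA0
  set P1 := μ.real {ω | ((A \ Z).filter fun a => offZ Z ω ∈ openConn o a).card = 1} with hP1
  set B := μ.real {ω | ((A \ Z).filter fun a => offZ Z ω ∈ openConn o a).card = 1 ∧ offZ Z ω ∈ openConn o c} with hB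
  set C := μ.real {ω | ((A \ Z).filter fun a => offZ Z ω ∈ openConn o a).card = 0 ∧ offZ Z ω ∈ openConn o c} with hC
  set g := μ.real {ω | offZ Z ω ∈ openConn o c} with hg
  set τ₀ := μ.real {ω | onZ Z ω ∈ openConn c a₀} with hτ₀
  set M := ∑ a ∈ A ∩ Z, μ.real {ω | onZ Z ω ∈ openConn c a} with hMdef
  set U := μ.real {ω | 1 ≤ ((A \ Z).filter fun a => offZ Z ω ∈ openConn o a).card} with hU
  set Sig := ∑ a ∈ A \ Z, μ.real (openConn o a) with hSig
  set K : ℝ := ((A \ Z).card : ℝ) with hK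
  set x := 1 - t with hx
  -- environment facts (as in `Block.real_intrinsic_env`)
  have hJ : g ≤ A0 + B + C := real_inter_J_le μ (A \ Z)
  have hHarU : U * g ≤ A0 + B := real_outCount_inter_ge w (A \ Z)
  have hUeq : U = P1 + A0 := by
    have hset : {ω : BondConfig (Fin n) | 1 ≤ ((A \ Z).filter fun a => offZ Z ω ∈ openConn o a).card} =
        {ω | ((A \ Z).filter fun a => offZ Z ω ∈ openConn o a).card = 1} ∪
          {ω | 2 ≤ ((A \ Z).filter fun a => offZ Z ω ∈ openConn o a).card} := by
      ext ω; simp only [mem_setOf_eq, Set.mem_union]; omega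
    have hdisj : Disjoint {ω : BondConfig (Fin n) | ((A \ Z).filter fun a => offZ Z ω ∈ openConn o a).card = 1}
        {ω | 2 ≤ ((A \ Z).filter fun a => offZ Z ω ∈ openConn o a).card} := by
      rw [Set.disjoint_left]; intro ω h1 h2; simp only [mem_setOf_eq] at h1 h2; omega
    rw [hU, hset, measureReal_union hdisj (hmeas _)]
  have hHar : (P1 + A0) * g ≤ A0 + B := by rw [← hUeq]; exact hHarU
  have hoff : ∀ a ∈ A \ Z, μ.real (openConn o a) = μ.real {ω | offZ Z ω ∈ openConn o a} :=
    fun a ha => real_openConn_off_eq (c := c) w ho hw (Finset.mem_sdiff.1 ha).2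
  have hSig' : Sig = ∑ a ∈ A \ Z, μ.real {ω | offZ Z ω ∈ openConn o a} := Finset.sum_congr rfl hoff
  have hcnt := sum_real_le_one_add_card_mul_two μ (A \ Z) (fun a => {ω : BondConfig (Fin n) | offZ Z ω ∈ openConn o a})
  have hSigle : Sig ≤ P1 + K * A0 := by
    have h1 := hcnt.1
    simp only [mem_setOf_eq] at h1
    rw [hSig']; exact h1
  have hP1S : P1 ≤ Sig := by
    have h2 := hcnt.2
    simp only [mem_setOf_eq] at h2
    rw [hSig']; exact h2
  have hKx : K * x ≤ Sig := by
    have : ∀ a ∈ A \ Z, x ≤ μ.real (openConn o a) := by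
      intro a ha
      have h1 := hcut a (Finset.mem_sdiff.1 ha).1
      have h2 : μ.real (openConn o a : Set (BondConfig (Fin n)))ᶜ = 1 - μ.real (openConn o a) := probReal_compl_eq_one_sub (hmeas _)
      rw [hx]; linarith
    calc K * x = ∑ a ∈ A \ Z, x := by rw [Finset.sum_const, nsmul_eq_mul]
      _ ≤ Sig := Finset.sum_le_sum this
  have hin : ∀ a ∈ A ∩ Z, μ.real (openConn o a) = g * μ.real {ω | onZ Z ω ∈ openConn c a} :=
    fun a ha => real_openConn_in_eq w ho hc hw (Finset.mem_inter.1 ha).2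
  have hENeq : ∑ a ∈ A, μ.real (openConn o a) = Sig + g * M := by
    have hsplit := Finset.sum_sdiff (f := fun a => μ.real (openConn o a)) (Finset.inter_subset_left (s₁ := A) (s₂ := Z))
    have hsd : A \ (A ∩ Z) = A \ Z := by
      ext a; simp only [Finset.mem_sdiff, Finset.mem_inter, not_and]; tauto
    rw [hsd] at hsplit
    rw [← hsplit, hMdef, Finset.mul_sum, Finset.sum_congr rfl hin]
  have hEN' : 2 < Sig + g * M := by rw [← hENeq]; exact hEN
  have hxg : x ≤ g * τ₀ := by
    have h1 := hcut a₀ (Finset.mem_inter.1 ha₀).1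
    have h2 : μ.real (openConn o a₀ : Set (BondConfig (Fin n)))ᶜ = 1 - μ.real (openConn o a₀) := probReal_compl_eq_one_sub (hmeas _)
    have h3 := hin a₀ ha₀
    rw [hx]; linarith
  have hg1 : g ≤ 1 := measureReal_le_one
  have hτ1 : τ₀ ≤ 1 := measureReal_le_one
  have hτM : τ₀ ≤ M := by
    rw [hMdef]
    exact Finset.single_le_sum (f := fun a => μ.real {ω | onZ Z ω ∈ openConn c a}) (fun _ _ => measureReal_nonneg) ha₀
  -- at least one outside relay: `Σ > 0` since `gM ≤ 2`
  have hgM : g * M ≤ 2 := by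
    have : g * M ≤ 1 * M := mul_le_mul_of_nonneg_right hg1 (le_trans measureReal_nonneg hτM)
    linarith
  have hK1 : (1 : ℝ) ≤ K := by
    have hne : (A \ Z).Nonempty := by
      by_contra hcon
      rw [Finset.not_nonempty_iff_eq_empty] at hcon
      have : Sig = 0 := by rw [hSig, hcon, Finset.sum_empty]
      linarith
    have : 1 ≤ (A \ Z).card := Finset.card_pos.2 hne
    rw [hK]; exact_mod_cast this
  exact intrinsic_arith_sharp measureReal_nonneg measureReal_nonneg measureReal_nonneg hK1
    measureReal_nonneg hg1 measureReal_nonneg hτ1 hd0 hdh hh1 hτM hM hJ hHar hKx hSigle hP1S hEN' hxg hB1 hB2l hB2m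

/-- **SHARP INTRINSIC CRITERION (FAR at layer one in every environment).**  Block `Z` at `c` (`o, c ∉ Z`, `w` vanishes between `Z` and
`(Z ∪ {c})ᶜ`), relays `A` with `P(o ↮ a) ≤ t` on `A` and `2 < Σ_{a∈A} P(o ↔ a)`; a block relay `a₀ ∈ A ∩ Z`, `τ₀ = P(c ↔ a₀ on Z)`; block numbers
`h_S`, `t_S`; inside mean `M_in ≤ 2`.  If (B1♯) `τ₀(τ₀ − t_S) ≤ 2t_S(1−τ₀)`, (B2♯-light) `M_in + τ₀ ≤ 2 → τ₀ − t_S ≤ (h_S − t_S)(2 − M_in)` and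
(B2♯-medium) `2 < M_in + τ₀ → (τ₀ − t_S)(M_in + τ₀) ≤ 2(h_S − t_S)τ₀`, then `P_w(#{a ∈ A : o ↔ a} ≤ 1) ≤ t`.  No hypothesis on the graph outside `Z`.
[this work] -/
theorem real_card_le_one_le_sharp (w : Sym2 (Fin n) → unitInterval) (ho : o ∉ Z) (hc : c ∉ Z)
    (hw : ∀ x y : Fin n, x ≠ y → x ∈ Z → y ∉ Z → y ≠ c → (w s(x, y) : ℝ) = 0)
    (A : Finset (Fin n)) (t : ℝ) {a₀ : Fin n} (ha₀ : a₀ ∈ A ∩ Z)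
    (hcut : ∀ a ∈ A, (prodBernoulli w).real (openConn o a)ᶜ ≤ t)
    (hEN : (2 : ℝ) < ∑ a ∈ A, (prodBernoulli w).real (openConn o a))
    (hM : ∑ a ∈ A ∩ Z, (prodBernoulli w).real {ω | onZ Z ω ∈ openConn c a} ≤ 2)
    (hB1 : (prodBernoulli w).real {ω | onZ Z ω ∈ openConn c a₀} *
        ((prodBernoulli w).real {ω | onZ Z ω ∈ openConn c a₀} -
          (prodBernoulli w).real {ω | 2 ≤ ((A ∩ Z).filter fun a => onZ Z ω ∈ openConn c a).card}) ≤
      2 * (prodBernoulli w).real {ω | 2 ≤ ((A ∩ Z).filter fun a => onZ Z ω ∈ openConn c a).card} *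
        (1 - (prodBernoulli w).real {ω | onZ Z ω ∈ openConn c a₀}))
    (hB2l : ∑ a ∈ A ∩ Z, (prodBernoulli w).real {ω | onZ Z ω ∈ openConn c a} + (prodBernoulli w).real {ω | onZ Z ω ∈ openConn c a₀} ≤ 2 →
      (prodBernoulli w).real {ω | onZ Z ω ∈ openConn c a₀} -
          (prodBernoulli w).real {ω | 2 ≤ ((A ∩ Z).filter fun a => onZ Z ω ∈ openConn c a).card} ≤
        ((prodBernoulli w).real {ω | 1 ≤ ((A ∩ Z).filter fun a => onZ Z ω ∈ openConn c a).card} -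
            (prodBernoulli w).real {ω | 2 ≤ ((A ∩ Z).filter fun a => onZ Z ω ∈ openConn c a).card}) *
          (2 - ∑ a ∈ A ∩ Z, (prodBernoulli w).real {ω | onZ Z ω ∈ openConn c a}))
    (hB2m : 2 < ∑ a ∈ A ∩ Z, (prodBernoulli w).real {ω | onZ Z ω ∈ openConn c a} + (prodBernoulli w).real {ω | onZ Z ω ∈ openConn c a₀} →
      ((prodBernoulli w).real {ω | onZ Z ω ∈ openConn c a₀} -
            (prodBernoulli w).real {ω | 2 ≤ ((A ∩ Z).filter fun a => onZ Z ω ∈ openConn c a).card}) *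
          (∑ a ∈ A ∩ Z, (prodBernoulli w).real {ω | onZ Z ω ∈ openConn c a} + (prodBernoulli w).real {ω | onZ Z ω ∈ openConn c a₀}) ≤
        2 * ((prodBernoulli w).real {ω | 1 ≤ ((A ∩ Z).filter fun a => onZ Z ω ∈ openConn c a).card} -
              (prodBernoulli w).real {ω | 2 ≤ ((A ∩ Z).filter fun a => onZ Z ω ∈ openConn c a).card}) *
          (prodBernoulli w).real {ω | onZ Z ω ∈ openConn c a₀}) :
    (prodBernoulli w).real {ω : BondConfig (Fin n) | (A.filter fun a => ω ∈ openConn o a).card ≤ 1} ≤ t := by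
  have htShS : (prodBernoulli w).real {ω | 2 ≤ ((A ∩ Z).filter fun a => onZ Z ω ∈ openConn c a).card} ≤
      (prodBernoulli w).real {ω | 1 ≤ ((A ∩ Z).filter fun a => onZ Z ω ∈ openConn c a).card} := by
    refine measureReal_mono (fun ω hω => ?_) (measure_ne_top _ _)
    simp only [mem_setOf_eq] at hω ⊢; omega
  have hkey := real_intrinsic_env_sharp w ho hc hw A t ha₀ hcut hEN hM measureReal_nonneg htShS measureReal_le_one hB1 hB2l hB2m
  rw [real_card_le_one_eq_one_sub, real_two_le_card_eq w ho hc hw A]; linarith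

/-- **SHARP INTRINSIC CRITERION, least-marginal form.**  As `real_card_le_one_le_sharp` with (B1♯) discharged by Harris: a second block relay
`a₁ ≠ a₀` of `A ∩ Z` with internal marginal `≥ τ₀` (e.g. `a₀` of least internal marginal) gives `t_S ≥ τ₀ τ₁ ≥ τ₀²`, hence (B1♯).  So a pendant
block with inside mean `M_in ≤ 2` satisfies FAR(1) in every environment as soon as (B2♯) holds — the condition that the 'stem + one hair'
environments impose. [this work] -/
theorem real_card_le_one_le_sharp₂ (w : Sym2 (Fin n) → unitInterval) (ho : o ∉ Z) (hc : c ∉ Z)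
    (hw : ∀ x y : Fin n, x ≠ y → x ∈ Z → y ∉ Z → y ≠ c → (w s(x, y) : ℝ) = 0)
    (A : Finset (Fin n)) (t : ℝ) {a₀ a₁ : Fin n} (ha₀ : a₀ ∈ A ∩ Z) (ha₁ : a₁ ∈ A ∩ Z) (hne : a₀ ≠ a₁)
    (hle : (prodBernoulli w).real {ω | onZ Z ω ∈ openConn c a₀} ≤ (prodBernoulli w).real {ω | onZ Z ω ∈ openConn c a₁})
    (hcut : ∀ a ∈ A, (prodBernoulli w).real (openConn o a)ᶜ ≤ t)
    (hEN : (2 : ℝ) < ∑ a ∈ A, (prodBernoulli w).real (openConn o a))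
    (hM : ∑ a ∈ A ∩ Z, (prodBernoulli w).real {ω | onZ Z ω ∈ openConn c a} ≤ 2)
    (hB2l : ∑ a ∈ A ∩ Z, (prodBernoulli w).real {ω | onZ Z ω ∈ openConn c a} + (prodBernoulli w).real {ω | onZ Z ω ∈ openConn c a₀} ≤ 2 →
      (prodBernoulli w).real {ω | onZ Z ω ∈ openConn c a₀} -
          (prodBernoulli w).real {ω | 2 ≤ ((A ∩ Z).filter fun a => onZ Z ω ∈ openConn c a).card} ≤
        ((prodBernoulli w).real {ω | 1 ≤ ((A ∩ Z).filter fun a => onZ Z ω ∈ openConn c a).card} -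
            (prodBernoulli w).real {ω | 2 ≤ ((A ∩ Z).filter fun a => onZ Z ω ∈ openConn c a).card}) *
          (2 - ∑ a ∈ A ∩ Z, (prodBernoulli w).real {ω | onZ Z ω ∈ openConn c a}))
    (hB2m : 2 < ∑ a ∈ A ∩ Z, (prodBernoulli w).real {ω | onZ Z ω ∈ openConn c a} + (prodBernoulli w).real {ω | onZ Z ω ∈ openConn c a₀} →
      ((prodBernoulli w).real {ω | onZ Z ω ∈ openConn c a₀} -
            (prodBernoulli w).real {ω | 2 ≤ ((A ∩ Z).filter fun a => onZ Z ω ∈ openConn c a).card}) *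
          (∑ a ∈ A ∩ Z, (prodBernoulli w).real {ω | onZ Z ω ∈ openConn c a} + (prodBernoulli w).real {ω | onZ Z ω ∈ openConn c a₀}) ≤
        2 * ((prodBernoulli w).real {ω | 1 ≤ ((A ∩ Z).filter fun a => onZ Z ω ∈ openConn c a).card} -
              (prodBernoulli w).real {ω | 2 ≤ ((A ∩ Z).filter fun a => onZ Z ω ∈ openConn c a).card}) *
          (prodBernoulli w).real {ω | onZ Z ω ∈ openConn c a₀}) :
    (prodBernoulli w).real {ω : BondConfig (Fin n) | (A.filter fun a => ω ∈ openConn o a).card ≤ 1} ≤ t := by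
  set τ₀ := (prodBernoulli w).real {ω | onZ Z ω ∈ openConn c a₀} with hτ₀
  set τ₁ := (prodBernoulli w).real {ω | onZ Z ω ∈ openConn c a₁} with hτ₁
  set tS := (prodBernoulli w).real {ω | 2 ≤ ((A ∩ Z).filter fun a => onZ Z ω ∈ openConn c a).card} with htS
  have hsq : τ₀ ^ 2 ≤ tS := by
    have h1 : τ₀ * τ₁ ≤ tS := real_blockTwo_ge_mul w A ha₀ ha₁ hne
    have h2 : τ₀ * τ₀ ≤ τ₀ * τ₁ := mul_le_mul_of_nonneg_left hle measureReal_nonneg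
    nlinarith
  have hτ0 : 0 ≤ τ₀ := measureReal_nonneg
  have hτ1 : τ₀ ≤ 1 := measureReal_le_one
  have htS0 : 0 ≤ tS := measureReal_nonneg
  have hB1 : τ₀ * (τ₀ - tS) ≤ 2 * tS * (1 - τ₀) := by
    -- `2 t_S (1−τ₀) − τ₀(τ₀ − t_S) = t_S (2 − τ₀) − τ₀² ≥ t_S − τ₀² ≥ 0`
    have e : 2 * tS * (1 - τ₀) - τ₀ * (τ₀ - tS) = (tS - τ₀ ^ 2) + tS * (1 - τ₀) := by ring
    have : 0 ≤ tS * (1 - τ₀) := mul_nonneg htS0 (by linarith)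
    linarith
  exact real_card_le_one_le_sharp w ho hc hw A t ha₀ hcut hEN hM hB1 hB2l hB2m

/-! ## Necessity: the 'stem + one hair' environments force (B2♯) -/

/-- **(B2♯-light) is necessary.**  Numbers `t` (= `t_S`), `s` (= `P(X = 1) ≥ 0`), `τ` (a block marginal with `τ ≤ t + s = h_S`), `M`
(inside mean) with `M + τ ≤ 2` (`τ ≤ 1` is only needed when `M > 1`, where it is automatic).  If the ONE-HAIR environments satisfy FAR(1) — for every hair weight `p ∈ (2 − M, 1]` (observer `= c`, so
`EN = M + p > 2`, `P(N ≥ 2) = t + p s`, least marginal `min(p, τ)`): `min(p, τ) ≤ t + p s` — then `τ − t ≤ s(2 − M)`. [this work] -/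
theorem sharp_light_of_oneHair {t s τ M : ℝ} (hs : 0 ≤ s) (hτh : τ ≤ t + s) (hl : M + τ ≤ 2)
    (H : ∀ p : ℝ, 2 - M < p → p ≤ 1 → min p τ ≤ t + p * s) : τ - t ≤ s * (2 - M) := by
  by_cases hM1 : M ≤ 1
  · have : s * 1 ≤ s * (2 - M) := mul_le_mul_of_nonneg_left (by linarith) hs
    linarith
  · have hM1' : 1 < M := lt_of_not_ge hM1
    have hτ1 : τ ≤ 1 := by linarith
    refine le_of_not_gt fun hcon => ?_
    rcases eq_or_lt_of_le hs with hs0 | hspos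
    · have h1 := H 1 (by linarith) le_rfl
      rw [min_eq_right hτ1, ← hs0] at h1
      rw [← hs0] at hcon
      linarith
    · -- `δ := (τ − t) − s(2 − M) > 0`; hair weight `p = min 1 (2 − M + δ/(2s))`
      set δ := (τ - t) - s * (2 - M) with hδ
      have hδpos : 0 < δ := by rw [hδ]; linarith
      set p := min 1 (2 - M + δ / (2 * s)) with hp
      have hp1 : p ≤ 1 := min_le_left _ _
      have hquot : 0 < δ / (2 * s) := div_pos hδpos (by linarith)
      have hp2 : 2 - M < p := by rw [hp]; exact lt_min (by linarith) (by linarith)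
      have hp3 : p ≤ 2 - M + δ / (2 * s) := min_le_right _ _
      have h1 := H p hp2 hp1
      rw [min_eq_right (by linarith : τ ≤ p)] at h1
      have h2 : p * s ≤ (2 - M + δ / (2 * s)) * s := mul_le_mul_of_nonneg_right hp3 hs
      have h3 : (2 - M + δ / (2 * s)) * s = (2 - M) * s + δ / 2 := by
        field_simp
      rw [h3, hδ] at h2
      linarith

/-- **(B2♯-medium) is necessary.**  Numbers `t`, `s ≥ 0`, `τ ∈ [0,1]`, `M` with `2 < M + τ`.  If the STEM + HAIR environments satisfy FAR(1) —
for every stem weight `g ∈ (0, 1]` and hair weight `p ∈ [0, 1]` with `2 < p + gM` (observer at the far end of the stem, carrying the hair: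
`EN = p + gM`, `P(N ≥ 2) = g(t + p s)`, least marginal `min(p, gτ)`): `min(p, gτ) ≤ g(t + p s)` — then `(τ − t)(M + τ) ≤ 2 s τ`. [this work] -/
theorem sharp_medium_of_stemHair {t s τ M : ℝ} (hs : 0 ≤ s) (hτ0 : 0 ≤ τ) (hτ1 : τ ≤ 1) (hm : 2 < M + τ)
    (H : ∀ g p : ℝ, 0 < g → g ≤ 1 → 0 ≤ p → p ≤ 1 → 2 < p + g * M → min p (g * τ) ≤ g * (t + p * s)) :
    (τ - t) * (M + τ) ≤ 2 * s * τ := by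
  have hS : 0 < M + τ := by linarith
  -- for `g ∈ (2/(M+τ), 1]` and `p = gτ`: `τ − t ≤ g τ s`
  have hstep : ∀ g : ℝ, 2 < g * (M + τ) → g ≤ 1 → τ - t ≤ g * (τ * s) := by
    intro g hg hg1
    have hgpos : 0 < g := by
      rcases le_or_gt g 0 with h' | h'
      · have : g * (M + τ) ≤ 0 := mul_nonpos_of_nonpos_of_nonneg h' hS.le
        linarith
      · exact h'
    have hpτ : g * τ ≤ 1 := by
      calc g * τ ≤ 1 * 1 := mul_le_mul hg1 hτ1 hτ0 zero_le_one
        _ = 1 := one_mul 1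
    have hEN : 2 < g * τ + g * M := by nlinarith
    have h1 := H g (g * τ) hgpos hg1 (mul_nonneg hgpos.le hτ0) hpτ hEN
    rw [min_self] at h1
    have h3 := le_of_mul_le_mul_left (h1.trans_eq (by ring : g * (t + g * τ * s) = g * (t + g * (τ * s)))) hgpos
    linarith
  refine le_of_not_gt fun hcon => ?_
  have h1 := hstep 1 (by linarith) le_rfl
  have hτs : 0 < τ * s := by
    rcases eq_or_lt_of_le (mul_nonneg hτ0 hs) with h0 | h0
    · rw [← h0] at h1
      have : (τ - t) * (M + τ) ≤ 0 * (M + τ) := mul_le_mul_of_nonneg_right (by linarith) hS.le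
      have : 0 ≤ 2 * s * τ := by positivity
      linarith
    · exact h0
  -- `g₀` with `g₀ · 2τs(M+τ) = (τ−t)(M+τ) + 2sτ`, strictly between the two sides
  set g₀ := ((τ - t) * (M + τ) + 2 * s * τ) / (2 * (τ * s) * (M + τ)) with hg₀
  have hden : 0 < 2 * (τ * s) * (M + τ) := by positivity
  have hg₀val : g₀ * (2 * (τ * s) * (M + τ)) = (τ - t) * (M + τ) + 2 * s * τ := by
    rw [hg₀]; exact div_mul_cancel₀ _ (ne_of_gt hden)
  have hg₀gt : 2 < g₀ * (M + τ) := by nlinarith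
  rcases le_or_gt g₀ 1 with hg₀1 | hg₀1
  · have h2 := hstep g₀ hg₀gt hg₀1
    have h3 : (τ - t) * (M + τ) ≤ g₀ * (τ * s) * (M + τ) := mul_le_mul_of_nonneg_right h2 hS.le
    nlinarith
  · -- `g₀ > 1`: `(τ−t)(M+τ) + 2sτ > 2τs(M+τ)`, contradicting `τ − t ≤ τ s` (the case `g = 1`) and `M + τ > 2`
    have h4 : 2 * (τ * s) * (M + τ) < (τ - t) * (M + τ) + 2 * s * τ := by
      have : 1 * (2 * (τ * s) * (M + τ)) < g₀ * (2 * (τ * s) * (M + τ)) := mul_lt_mul_of_pos_right hg₀1 hden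
      linarith
    have h5 : (τ - t) * (M + τ) ≤ τ * s * (M + τ) := mul_le_mul_of_nonneg_right (by linarith) hS.le
    nlinarith

end Block

end Quant

end Summit.CriticalPhenomena.PercolationContinuityZ3.Theorems
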